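import Mathlib.Data.List.Sort
import Mathlib.Data.Fintype.Card
import Literature.Computability.FineGrained.BKGadget
import Literature.Computability.Cryptography.FGCoreProblems
import HarnessLib

/-!
# From Orthogonal Vectors to binary edit distance: the three gadget levels of Bringmann–Künnemann

The combinatorial core of the reduction OV → Levenshtein distance on `{0,1}` (K. Bringmann,
M. Künnemann, *Quadratic conditional lower bounds for string problems and dynamic time warping*,
FOCS 2015, arXiv:1502.01063, **§3.1, proof of Thm. 3.3**, instantiated with the coordinate values
of Lemma 5.2 and the alignment gadget of Lemmas 5.3–5.4 for `EDIT(c_subst)`, `c_subst = 1`), on top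
of the objects of `Literature.Computability.FineGrained.BKGadget` (`Params.gadgetX/gadgetY/C`, the
coordinate values `oneX, zeroX, oneY, zeroY`, and the named fact `alignmentGadget_editDist` =
BK15 Lemma 5.4). For an OV instance `I = (n, d, A, B)` (`Cryptography.OVInstance`):

* level 1 (parameters `P₁ = (5, 5, 3)`): coordinate gadgets `cgX a k ∈ {0ₓ, 1ₓ}`, `cgX a d = 0ₓ`,
  `cgY b k ∈ {0_y, 1_y}`, `cgY b d = 1_y`, `cgS d k = 0ₓ (k < d)`, `cgS d d = 1ₓ`; vector gadgets
  `vgX a = GA_x(cgX a 0, …, cgX a d)`, `vgY b = GA_y(cgY b 0, …, cgY b d)`, `vgS d = GA_x(0ₓ,…,0ₓ,1ₓ)`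
  (BK15 §3.1, `VG(aᵢ)`, `VG(bⱼ)`, `S`); **Claim 3.4** (`editDist_vgX_vgY_of_areOrthogonal`,
  `le_editDist_vgX_vgY_of_not_areOrthogonal`, `editDist_vgS_vgY`);
* level 2 (parameters `P₂ d` = type of `vgX`, length of `vgY`): normalised vector gadgets
  `nvgX a = GA_x(S, VG a)`, `nvgY b = GA_y(VG b)`; **Claim 3.5** (`editDist_nvgX_nvgY`: the distance is
  `ρ₀' d` if `⟨a,b⟩ = 0` and `ρ₁' d` otherwise, `ρ₀' < ρ₁'`);
* level 3 (parameters `P₃ d`): `ovX I = GA_x(NVG a₀,…,NVG a_{n-1},NVG a₀,…,NVG a_{n-1})`,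
  `ovY I = GA_y(NVG b₀,…,NVG b_{n-1})`, the threshold
  `ovThreshold I = C₃ + (n-1) ρ₁' + ρ₀'`; **Claim 3.6** and the conclusion of the proof of Thm. 3.3
  (`editDist_ovX_ovY_le_iff`): for `n ≥ 1`,
  `editDist (ovX I) (ovY I) ≤ ovThreshold I ↔ I.HasOrthogonalPair`.

All distance statements take BK15 Lemma 5.4 as the hypothesis `(hAG : alignmentGadget_editDist)`
(a named fact of `BKGadget`); the side conditions of that fact (`1 ≤ m ≤ n`, common type of the
`xᵢ`, common length of the `yⱼ`, `ℓₓ ≤ ℓ_y`) are verified at each level (`length_vgX`, `count_vgX`,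
…, `P₃_ℓx_le_ℓy`). Closed forms of all lengths are provided for the machine-level reduction
(`length_ovX`, `length_ovY`).

## What is not here

The word-RAM program writing `ovX I, ovY I` and running a hypothetical edit-distance program
(the named fact `ovInTimePolyDim_of_editDistance_inTimeO` of `EditDistanceSETH.lean`), and the
proof of Lemma 5.4 itself.
-/

namespace Literature.Computability.FineGrained

open Cryptography

namespace BKGadget

/-! ### Generic facts: alignments, their number of pairs, their cost -/

section generic

variable {n m : ℕ}

/-- An alignment has at most `m` pairs (its second components are strictly increasing in
`Fin m`). [cite: BringmannKunnemannFOCS2015, §3 (Alignments)] -/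
theorem IsAlignment.length_le {A : List (Fin n × Fin m)} (hA : IsAlignment A) : A.length ≤ m := by
  have h2 : (A.map Prod.snd).Pairwise (· < ·) := by
    rw [List.pairwise_map]; exact hA.imp fun h => h.2
  have hnd : (A.map Prod.snd).Nodup := h2.imp ne_of_lt
  simpa using hnd.length_le_card

/-- A strictly increasing list of naturals `< n` of length `n` is `[0, 1, …, n-1]`. [folklore] -/
theorem eq_range_of_pairwise_lt {l : List ℕ} {n : ℕ} (hl : l.Pairwise (· < ·))
    (hb : ∀ a ∈ l, a < n) (hlen : l.length = n) : l = List.range n := by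
  have hnd : l.Nodup := hl.imp ne_of_lt
  have hsub : l.toFinset ⊆ Finset.range n := fun a ha => by
    rw [List.mem_toFinset] at ha; exact Finset.mem_range.2 (hb a ha)
  have hcard : (Finset.range n).card ≤ l.toFinset.card := by
    rw [Finset.card_range, List.toFinset_card_of_nodup hnd, hlen]
  have heq : l.toFinset = Finset.range n := Finset.eq_of_subset_of_card_le hsub hcard
  refine hl.eq_of_mem_iff List.pairwise_lt_range fun a => ?_
  rw [← List.mem_toFinset, heq, Finset.mem_range, List.mem_range]

/-- In an alignment of `[n]` into `[n]` with `n` pairs, the `k`-th pair is `(k, k)`.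
[cite: BringmannKunnemannFOCS2015, Claim 3.4 (proof: "if |A| = d+1 then A = {(1,1),…,(d+1,d+1)}")] -/
theorem IsAlignment.getElem_eq_of_length_eq {A : List (Fin n × Fin n)} (hA : IsAlignment A)
    (hlen : A.length = n) (k : ℕ) (hk : k < A.length) :
    ((A[k].1 : ℕ) = k) ∧ ((A[k].2 : ℕ) = k) := by
  have h1 : (A.map fun p => (p.1 : ℕ)) = List.range n := by
    refine eq_range_of_pairwise_lt ?_ (fun a ha => ?_) (by simp [hlen])
    · rw [List.pairwise_map]; exact hA.imp fun h => h.1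
    · obtain ⟨p, -, rfl⟩ := List.mem_map.1 ha; exact p.1.isLt
  have h2 : (A.map fun p => (p.2 : ℕ)) = List.range n := by
    refine eq_range_of_pairwise_lt ?_ (fun a ha => ?_) (by simp [hlen])
    · rw [List.pairwise_map]; exact hA.imp fun h => h.2
    · obtain ⟨p, -, rfl⟩ := List.mem_map.1 ha; exact p.2.isLt
  constructor
  · have := congrArg (fun l => l[k]?) h1
    simp only [List.getElem?_map, List.getElem?_eq_getElem hk, Option.map_some,
      List.getElem?_range (hlen ▸ hk)] at this
    exact Option.some_injective _ this
  · have := congrArg (fun l => l[k]?) h2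
    simp only [List.getElem?_map, List.getElem?_eq_getElem hk, Option.map_some,
      List.getElem?_range (hlen ▸ hk)] at this
    exact Option.some_injective _ this

/-- In an alignment of `[n]` into `[n]` with `n` pairs, every diagonal pair `(k, k)` occurs.
[cite: BringmannKunnemannFOCS2015, Claim 3.4 (proof)] -/
theorem IsAlignment.mem_of_length_eq {A : List (Fin n × Fin n)} (hA : IsAlignment A)
    (hlen : A.length = n) (k : Fin n) : (k, k) ∈ A := by
  have hk : (k : ℕ) < A.length := by rw [hlen]; exact k.isLt
  obtain ⟨h1, h2⟩ := hA.getElem_eq_of_length_eq hlen k hk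
  have : A[(k : ℕ)] = (k, k) := Prod.ext (Fin.ext h1) (Fin.ext h2)
  exact this ▸ List.getElem_mem hk

/-- The punishment term is bounded by any common bound of the distances. [folklore] -/
theorem maxDist_le {x : Fin n → List Bool} {y : Fin m → List Bool} {c : ℕ}
    (h : ∀ i j, editDist (x i) (y j) ≤ c) : maxDist x y ≤ c :=
  Finset.sup_le fun p _ => h p.1 p.2

/-- **Uniform lower bound on the cost of an alignment**: if every distance `δ(xᵢ, yⱼ)` is at
least `c` (and there is at least one `xᵢ`), every alignment costs at least `m · c`.
[cite: BringmannKunnemannFOCS2015, Claims 3.4 and 3.6 (proofs)] -/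
theorem mul_le_alignCost {x : Fin n → List Bool} {y : Fin m → List Bool} {c : ℕ} (hn : 0 < n)
    (h : ∀ i j, c ≤ editDist (x i) (y j)) {A : List (Fin n × Fin m)} (hA : IsAlignment A) :
    m * c ≤ alignCost x y A := by
  have hlen := hA.length_le
  have hsum : A.length * c ≤ (A.map fun p => editDist (x p.1) (y p.2)).sum := by
    have : ∀ v ∈ A.map (fun p => editDist (x p.1) (y p.2)), c ≤ v := by
      intro v hv
      obtain ⟨p, -, rfl⟩ := List.mem_map.1 hv
      exact h p.1 p.2
    simpa using List.card_nsmul_le_sum _ c this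
  have hmax : (m - A.length) * c ≤ (m - A.length) * maxDist x y := by
    rcases Nat.eq_zero_or_pos m with hm | hm
    · simp [hm]
    · exact Nat.mul_le_mul_left _
        ((h ⟨0, hn⟩ ⟨0, hm⟩).trans (editDist_le_maxDist x y ⟨0, hn⟩ ⟨0, hm⟩))
  unfold alignCost
  have : m * c = A.length * c + (m - A.length) * c := by
    rw [← Nat.add_mul, Nat.add_sub_cancel' hlen]
  omega

/-- The sum of the distances over the pairs of `A` is at least `2 |A| + 2` when all distances
are `≥ 2` and some pair of `A` has distance `≥ 4`. [folklore] -/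
theorem sum_map_ge_of_mem {x : Fin n → List Bool} {y : Fin m → List Bool}
    (h2 : ∀ i j, 2 ≤ editDist (x i) (y j)) {A : List (Fin n × Fin m)} {p₀ : Fin n × Fin m}
    (hp₀ : p₀ ∈ A) (h4 : 4 ≤ editDist (x p₀.1) (y p₀.2)) :
    2 * A.length + 2 ≤ (A.map fun p => editDist (x p.1) (y p.2)).sum := by
  have hperm := List.perm_cons_erase hp₀
  have hsum : (A.map fun p => editDist (x p.1) (y p.2)).sum =
      editDist (x p₀.1) (y p₀.2) + ((A.erase p₀).map fun p => editDist (x p.1) (y p.2)).sum := by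
    rw [(hperm.map _).sum_eq]; simp
  have hlenE : (A.erase p₀).length + 1 = A.length := by
    rw [List.length_erase_of_mem hp₀]
    have : 0 < A.length := List.length_pos_of_mem hp₀
    omega
  have hrest : (A.erase p₀).length * 2 ≤
      ((A.erase p₀).map fun p => editDist (x p.1) (y p.2)).sum := by
    have : ∀ v ∈ (A.erase p₀).map (fun p => editDist (x p.1) (y p.2)), 2 ≤ v := by
      intro v hv
      obtain ⟨p, -, rfl⟩ := List.mem_map.1 hv
      exact h2 p.1 p.2
    simpa using List.card_nsmul_le_sum _ 2 this
  omega

end generic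

/-! ### Counting the ones of a gadget string -/

namespace Params

variable (P : Params)

/-- Number of ones of the first gadget string for inputs with a common number `s` of ones:
`#₁ x = n (4γ₁ + s)`. [folklore] -/
theorem count_true_gadgetX {s : ℕ} (xs : List (List Bool)) (h : ∀ z ∈ xs, z.count true = s) :
    (P.gadgetX xs).count true = xs.length * (4 * P.γ₁ + s) := by
  induction xs with
  | nil => simp [gadgetX]
  | cons z xs ih =>
      have hz : z.count true = s := h z (by simp)
      have h' : ∀ w ∈ xs, w.count true = s := fun w hw => h w (by simp [hw])
      rcases xs with _ | ⟨w, xs⟩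
      · simp [gadgetX, hz]
      · have ih' := ih h'
        simp only [gadgetX, List.map_cons, List.intercalate_cons_cons, List.count_append,
          count_true_guard, count_true_zeros, List.length_cons] at ih' ⊢
        rw [ih', hz]
        ring

end Params

end BKGadget

/-! ## The reduction of BK15 §3.1 for Levenshtein distance on bit strings -/

namespace BKReduction

open BKGadget

/-! ### Level 1: coordinate gadgets and vector gadgets -/

/-- The level-1 parameters: the coordinate values have type `(5, 3)` on both sides
(BK15 Lemma 5.2), so `ℓₓ = ℓ_y = 5`, `sₓ = 3`. [cite: BringmannKunnemannFOCS2015, §3.1 with Lemma 5.2] -/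
def P₁ : Params := ⟨5, 5, 3⟩

variable {d : ℕ}

/-- The coordinate gadgets of a vector `a` of the first list: `CG(a, k) = 0ₓ / 1ₓ` according to
`a[k]` for `k < d`, and `CG(a, d) = 0ₓ` (BK15 §3.1). [cite: BringmannKunnemannFOCS2015, §3.1 (coordinate gadgets)] -/
def cgX (a : Fin d → Bool) (k : Fin (d + 1)) : List Bool :=
  if h : (k : ℕ) < d then (if a ⟨k, h⟩ then oneX else zeroX) else zeroX

/-- The coordinate gadgets of a vector `b` of the second list: `CG(b, k) = 0_y / 1_y` according
to `b[k]` for `k < d`, and `CG(b, d) = 1_y` (BK15 §3.1). [cite: BringmannKunnemannFOCS2015, §3.1 (coordinate gadgets)] -/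
def cgY (b : Fin d → Bool) (k : Fin (d + 1)) : List Bool :=
  if h : (k : ℕ) < d then (if b ⟨k, h⟩ then oneY else zeroY) else oneY

/-- The coordinates of the special string `S = GA_x(0ₓ, …, 0ₓ, 1ₓ)` (BK15 §3.1).
[cite: BringmannKunnemannFOCS2015, §3.1 (the string S)] -/
def cgS (d : ℕ) (k : Fin (d + 1)) : List Bool :=
  if (k : ℕ) < d then zeroX else oneX

/-- The vector gadget `VG(a) = GA_x^{d+1}(CG(a,0), …, CG(a,d))` (BK15 §3.1, level 1 of the
alignment gadget of Lemma 5.3). [cite: BringmannKunnemannFOCS2015, §3.1 (vector gadgets)] -/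
def vgX (a : Fin d → Bool) : List Bool :=
  P₁.gadgetX (List.ofFn (cgX a))

/-- The vector gadget `VG(b) = GA_y^{d+1}(CG(b,0), …, CG(b,d))` (BK15 §3.1).
[cite: BringmannKunnemannFOCS2015, §3.1 (vector gadgets)] -/
def vgY (b : Fin d → Bool) : List Bool :=
  P₁.gadgetY (d + 1) (List.ofFn (cgY b))

/-- The special vector gadget `S = GA_x^{d+1}(0ₓ, …, 0ₓ, 1ₓ)` (BK15 §3.1).
[cite: BringmannKunnemannFOCS2015, §3.1 (the string S)] -/
def vgS (d : ℕ) : List Bool :=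
  P₁.gadgetX (List.ofFn (cgS d))

/-- `C₁ = C(d+1, d+1)`, the offset of the level-1 alignment gadget. [cite: BringmannKunnemannFOCS2015, §3.1 (the constant C)] -/
def C₁ (d : ℕ) : ℕ := P₁.C (d + 1) (d + 1)

/-- Every `x`-side coordinate gadget has length `5`. [cite: BringmannKunnemannFOCS2015, Lemma 5.2] -/
theorem length_cgX (a : Fin d → Bool) (k : Fin (d + 1)) : (cgX a k).length = 5 := by
  unfold cgX; split_ifs <;> rfl

/-- Every `x`-side coordinate gadget has `3` ones. [cite: BringmannKunnemannFOCS2015, Lemma 5.2] -/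
theorem count_cgX (a : Fin d → Bool) (k : Fin (d + 1)) : (cgX a k).count true = 3 := by
  unfold cgX; split_ifs <;> rfl

/-- Every `y`-side coordinate gadget has length `5`. [cite: BringmannKunnemannFOCS2015, Lemma 5.2] -/
theorem length_cgY (b : Fin d → Bool) (k : Fin (d + 1)) : (cgY b k).length = 5 := by
  unfold cgY; split_ifs <;> rfl

/-- Every coordinate of `S` has length `5`. [cite: BringmannKunnemannFOCS2015, Lemma 5.2] -/
theorem length_cgS (d : ℕ) (k : Fin (d + 1)) : (cgS d k).length = 5 := by
  unfold cgS; split_ifs <;> rfl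

/-- Every coordinate of `S` has `3` ones. [cite: BringmannKunnemannFOCS2015, Lemma 5.2] -/
theorem count_cgS (d : ℕ) (k : Fin (d + 1)) : (cgS d k).count true = 3 := by
  unfold cgS; split_ifs <;> rfl

/-- The coordinate distances are `2` or `4` … [cite: BringmannKunnemannFOCS2015, Lemma 5.2] -/
theorem two_le_editDist_cgX_cgY (a b : Fin d → Bool) (k l : Fin (d + 1)) :
    2 ≤ editDist (cgX a k) (cgY b l) ∧ editDist (cgX a k) (cgY b l) ≤ 4 := by
  unfold cgX cgY
  split_ifs <;> simp [editDist_zeroX_zeroY, editDist_zeroX_oneY, editDist_oneX_zeroY,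
    editDist_oneX_oneY]

/-- … and `4` exactly when both coordinates are (genuine and) `1`. [cite: BringmannKunnemannFOCS2015, Lemma 5.2] -/
theorem editDist_cgX_cgY_self (a b : Fin d → Bool) (k : Fin (d + 1)) :
    editDist (cgX a k) (cgY b k) =
      if ∃ h : (k : ℕ) < d, a ⟨k, h⟩ = true ∧ b ⟨k, h⟩ = true then 4 else 2 := by
  unfold cgX cgY
  by_cases hk : (k : ℕ) < d
  · simp only [hk, dite_true, exists_true_left]
    cases a ⟨k, hk⟩ <;> cases b ⟨k, hk⟩ <;> simp [editDist_zeroX_zeroY, editDist_zeroX_oneY,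
      editDist_oneX_zeroY, editDist_oneX_oneY]
  · simp [hk, editDist_zeroX_oneY]

/-- The coordinate distances of `S` are `2` or `4` … [cite: BringmannKunnemannFOCS2015, Lemma 5.2] -/
theorem two_le_editDist_cgS_cgY (b : Fin d → Bool) (k l : Fin (d + 1)) :
    2 ≤ editDist (cgS d k) (cgY b l) ∧ editDist (cgS d k) (cgY b l) ≤ 4 := by
  unfold cgS cgY
  split_ifs <;> simp [editDist_zeroX_zeroY, editDist_zeroX_oneY, editDist_oneX_zeroY,
    editDist_oneX_oneY]

/-- … namely `2` on the diagonal below `d` and `4` at `(d, d)`. [cite: BringmannKunnemannFOCS2015, Claim 3.4 (proof)] -/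
theorem editDist_cgS_cgY_self (b : Fin d → Bool) (k : Fin (d + 1)) :
    editDist (cgS d k) (cgY b k) = if (k : ℕ) < d then 2 else 4 := by
  unfold cgS cgY
  by_cases hk : (k : ℕ) < d
  · simp only [hk, dite_true, ite_true]
    cases b ⟨k, hk⟩ <;> simp [editDist_zeroX_zeroY, editDist_zeroX_oneY]
  · simp [hk, editDist_oneX_oneY]

/-- `|VG(a)| = (d+1)(8γ₁ + 5) + d γ₂` (level-1 parameters). [folklore] -/
theorem length_vgX (a : Fin d → Bool) :
    (vgX a).length = (d + 1) * (8 * P₁.γ₁ + 5) + d * P₁.γ₂ := by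
  unfold vgX
  rw [P₁.length_gadgetX (ℓ := 5) _ (by simp [List.mem_ofFn', length_cgX])]
  simp

/-- `#₁ VG(a) = (d+1)(4γ₁ + 3)`. [folklore] -/
theorem count_vgX (a : Fin d → Bool) : (vgX a).count true = (d + 1) * (4 * P₁.γ₁ + 3) := by
  unfold vgX
  rw [P₁.count_true_gadgetX (s := 3) _ (by simp [List.mem_ofFn', count_cgX])]
  simp

/-- `|S| = |VG(a)|`. [folklore] -/
theorem length_vgS (d : ℕ) : (vgS d).length = (d + 1) * (8 * P₁.γ₁ + 5) + d * P₁.γ₂ := by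
  unfold vgS
  rw [P₁.length_gadgetX (ℓ := 5) _ (by simp [List.mem_ofFn', length_cgS])]
  simp

/-- `#₁ S = #₁ VG(a)`. [folklore] -/
theorem count_vgS (d : ℕ) : (vgS d).count true = (d + 1) * (4 * P₁.γ₁ + 3) := by
  unfold vgS
  rw [P₁.count_true_gadgetX (s := 3) _ (by simp [List.mem_ofFn', count_cgS])]
  simp

/-- `|VG(b)| = 2 (d+1) γ₃ + (d+1)(8γ₁ + 5) + d γ₂`. [folklore] -/
theorem length_vgY (b : Fin d → Bool) :
    (vgY b).length = 2 * ((d + 1) * P₁.γ₃) + ((d + 1) * (8 * P₁.γ₁ + 5) + d * P₁.γ₂) := by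
  unfold vgY
  rw [P₁.length_gadgetY (ℓ := 5) _ _ (by simp [List.mem_ofFn', length_cgY])]
  simp

section level1

variable (hAG : alignmentGadget_editDist)
include hAG

/-- Lemma 5.4 at level 1, for the inputs `cgX a` / `cgY b`. [cite: BringmannKunnemannFOCS2015, Lemma 5.4] -/
theorem gadget₁ (x : Fin (d + 1) → List Bool) (hx : ∀ k, (x k).length = 5)
    (hxc : ∀ k, (x k).count true = 3) (b : Fin d → Bool) :
    (∀ (Δ : ℕ) (hΔ : Δ + (d + 1) ≤ d + 1),
        editDist (P₁.gadgetX (List.ofFn x)) (vgY b) ≤ C₁ d + structuredCost x (cgY b) Δ hΔ) ∧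
    (∃ A : List (Fin (d + 1) × Fin (d + 1)), IsAlignment A ∧
        C₁ d + alignCost x (cgY b) A ≤ editDist (P₁.gadgetX (List.ofFn x)) (vgY b)) :=
  hAG (d + 1) (d + 1) P₁ x (cgY b) (Nat.succ_pos d) le_rfl le_rfl hx hxc (length_cgY b)

/-- **Claim 3.4, orthogonal case**: `δ(VG a, VG b) = C₁ + (d+1) ρ₀` with `ρ₀ = 2`.
[cite: BringmannKunnemannFOCS2015, Claim 3.4] -/
theorem editDist_vgX_vgY_of_areOrthogonal {a b : Fin d → Bool} (h : AreOrthogonal a b) :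
    editDist (vgX a) (vgY b) = C₁ d + (2 * d + 2) := by
  obtain ⟨hup, A, hA, hlow⟩ := gadget₁ hAG (cgX a) (length_cgX a) (count_cgX a) b
  apply le_antisymm
  · -- the structured alignment `Δ = 0` costs `(d+1) · 2`
    refine (hup 0 (by simp)).trans (Nat.add_le_add_left (le_of_eq ?_) _)
    unfold structuredCost
    refine (Finset.sum_congr rfl (g := fun _ => 2) fun k _ => ?_).trans ?_
    · rw [show (⟨0 + (k : ℕ), by omega⟩ : Fin (d + 1)) = k from Fin.ext (by simp),
        editDist_cgX_cgY_self, if_neg]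
      rintro ⟨hk, hak, hbk⟩
      exact h ⟨k, hk⟩ ⟨hak, hbk⟩
    · rw [Finset.sum_const, Finset.card_univ, Fintype.card_fin, smul_eq_mul]
      ring
  · -- every alignment costs at least `(d+1) · 2`
    refine le_trans (Nat.add_le_add_left ?_ _) hlow
    have := mul_le_alignCost (Nat.succ_pos d) (fun i j => (two_le_editDist_cgX_cgY a b i j).1) hA
    linarith

/-- **Claim 3.4, non-orthogonal case**: `δ(VG a, VG b) ≥ C₁ + d ρ₀ + ρ₁` with `ρ₀ = 2`, `ρ₁ = 4`.
[cite: BringmannKunnemannFOCS2015, Claim 3.4] -/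
theorem le_editDist_vgX_vgY_of_not_areOrthogonal {a b : Fin d → Bool} (h : ¬ AreOrthogonal a b) :
    C₁ d + (2 * d + 4) ≤ editDist (vgX a) (vgY b) := by
  obtain ⟨-, A, hA, hlow⟩ := gadget₁ hAG (cgX a) (length_cgX a) (count_cgX a) b
  refine le_trans (Nat.add_le_add_left ?_ _) hlow
  -- a coordinate where both vectors are `1`
  obtain ⟨k, hk⟩ : ∃ k : Fin d, a k = true ∧ b k = true := by
    by_contra hne
    exact h fun k hk' => hne ⟨k, hk'⟩
  set k' : Fin (d + 1) := ⟨k, Nat.lt_succ_of_lt k.isLt⟩ with hk'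
  have h4 : editDist (cgX a k') (cgY b k') = 4 := by
    rw [editDist_cgX_cgY_self, if_pos ⟨k.isLt, by simpa using hk⟩]
  have hmax : maxDist (cgX a) (cgY b) = 4 :=
    le_antisymm (maxDist_le fun i j => (two_le_editDist_cgX_cgY a b i j).2)
      (h4 ▸ editDist_le_maxDist _ _ k' k')
  have hlen := hA.length_le
  unfold alignCost
  rw [hmax]
  rcases hlen.lt_or_eq with hlt | heq
  · -- a punishment term `4` occurs
    have hsum : A.length * 2 ≤ (A.map fun p => editDist (cgX a p.1) (cgY b p.2)).sum := by
      have : ∀ v ∈ A.map (fun p => editDist (cgX a p.1) (cgY b p.2)), 2 ≤ v := by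
        intro v hv
        obtain ⟨p, -, rfl⟩ := List.mem_map.1 hv
        exact (two_le_editDist_cgX_cgY a b p.1 p.2).1
      simpa using List.card_nsmul_le_sum _ 2 this
    have : 1 ≤ d + 1 - A.length := by omega
    omega
  · -- the alignment is the diagonal and contains `(k', k')`
    have hmem : (k', k') ∈ A := hA.mem_of_length_eq heq k'
    have := sum_map_ge_of_mem (fun i j => (two_le_editDist_cgX_cgY a b i j).1) hmem h4.ge
    rw [heq] at this ⊢
    simp only [Nat.sub_self, zero_mul, add_zero]
    omega

/-- **Claim 3.4, the string `S`**: `δ(S, VG b) = C₁ + d ρ₀ + ρ₁`. [cite: BringmannKunnemannFOCS2015, Claim 3.4] -/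
theorem editDist_vgS_vgY (b : Fin d → Bool) : editDist (vgS d) (vgY b) = C₁ d + (2 * d + 4) := by
  obtain ⟨hup, A, hA, hlow⟩ := gadget₁ hAG (cgS d) (length_cgS d) (count_cgS d) b
  apply le_antisymm
  · refine (hup 0 (by simp)).trans (Nat.add_le_add_left (le_of_eq ?_) _)
    unfold structuredCost
    refine (Finset.sum_congr rfl (g := fun k : Fin (d + 1) => if (k : ℕ) < d then (2 : ℕ) else 4)
      fun k _ => ?_).trans ?_
    · rw [show (⟨0 + (k : ℕ), by omega⟩ : Fin (d + 1)) = k from Fin.ext (by simp),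
        editDist_cgS_cgY_self]
    · rw [Fin.sum_univ_castSucc]
      simp only [Fin.val_castSucc, Fin.is_lt, ite_true, Finset.sum_const, Finset.card_univ,
        Fintype.card_fin, smul_eq_mul, Fin.val_last, lt_self_iff_false, ite_false]
      ring
  · refine le_trans (Nat.add_le_add_left ?_ _) hlow
    set k' : Fin (d + 1) := Fin.last d with hk'
    have h4 : editDist (cgS d k') (cgY b k') = 4 := by
      rw [editDist_cgS_cgY_self, if_neg (by simp [hk'])]
    have hmax : maxDist (cgS d) (cgY b) = 4 :=
      le_antisymm (maxDist_le fun i j => (two_le_editDist_cgS_cgY b i j).2)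
        (h4 ▸ editDist_le_maxDist _ _ k' k')
    have hlen := hA.length_le
    unfold alignCost
    rw [hmax]
    rcases hlen.lt_or_eq with hlt | heq
    · have hsum : A.length * 2 ≤ (A.map fun p => editDist (cgS d p.1) (cgY b p.2)).sum := by
        have : ∀ v ∈ A.map (fun p => editDist (cgS d p.1) (cgY b p.2)), 2 ≤ v := by
          intro v hv
          obtain ⟨p, -, rfl⟩ := List.mem_map.1 hv
          exact (two_le_editDist_cgS_cgY b p.1 p.2).1
        simpa using List.card_nsmul_le_sum _ 2 this
      have : 1 ≤ d + 1 - A.length := by omega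
      omega
    · have hmem : (k', k') ∈ A := hA.mem_of_length_eq heq k'
      have := sum_map_ge_of_mem (fun i j => (two_le_editDist_cgS_cgY b i j).1) hmem h4.ge
      rw [heq] at this ⊢
      simp only [Nat.sub_self, zero_mul, add_zero]
      omega

end level1

/-! ### Level 2: normalised vector gadgets -/

/-- The level-2 parameters: the common type `(|VG a|, #₁ VG a)` of `S, VG(a₁), …` and the common
length `|VG b|` (BK15 §3.1, `t_x'`, `t_y'`). [cite: BringmannKunnemannFOCS2015, §3.1 (types t_x', t_y')] -/
def P₂ (d : ℕ) : Params where
  ℓx := (d + 1) * (8 * P₁.γ₁ + 5) + d * P₁.γ₂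
  ℓy := 2 * ((d + 1) * P₁.γ₃) + ((d + 1) * (8 * P₁.γ₁ + 5) + d * P₁.γ₂)
  sx := (d + 1) * (4 * P₁.γ₁ + 3)

/-- The two `x`-inputs `(S, VG a)` of the level-2 gadget. [cite: BringmannKunnemannFOCS2015, §3.1 (NVG(aᵢ))] -/
def pairSX (a : Fin d → Bool) : Fin 2 → List Bool :=
  fun i => if (i : ℕ) = 0 then vgS d else vgX a

/-- The `y`-input `(VG b)` of the level-2 gadget. [cite: BringmannKunnemannFOCS2015, §3.1 (NVG(bⱼ))] -/
def singleY (b : Fin d → Bool) : Fin 1 → List Bool :=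
  fun _ => vgY b

/-- The normalised vector gadget `NVG(a) = GA_x^{1}(S, VG(a))` (BK15 §3.1).
[cite: BringmannKunnemannFOCS2015, §3.1 (normalized vector gadgets)] -/
def nvgX (a : Fin d → Bool) : List Bool :=
  (P₂ d).gadgetX (List.ofFn (pairSX a))

/-- The normalised vector gadget `NVG(b) = GA_y^{2}(VG(b))` (BK15 §3.1).
[cite: BringmannKunnemannFOCS2015, §3.1 (normalized vector gadgets)] -/
def nvgY (b : Fin d → Bool) : List Bool :=
  (P₂ d).gadgetY 2 (List.ofFn (singleY b))

/-- `C₂ = C'`, the offset of the level-2 alignment gadget (`n = 2`, `m = 1`). [cite: BringmannKunnemannFOCS2015, §3.1 (the constant C')] -/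
def C₂ (d : ℕ) : ℕ := (P₂ d).C 2 1

/-- `ρ₀' = C + C' + (d+1) ρ₀`, the distance of the normalised gadgets of an orthogonal pair
(BK15 Claim 3.5). [cite: BringmannKunnemannFOCS2015, Claim 3.5] -/
def ρ₀' (d : ℕ) : ℕ := C₂ d + (C₁ d + (2 * d + 2))

/-- `ρ₁' = C + C' + d ρ₀ + ρ₁`, the distance of the normalised gadgets of a non-orthogonal pair
(BK15 Claim 3.5). [cite: BringmannKunnemannFOCS2015, Claim 3.5] -/
def ρ₁' (d : ℕ) : ℕ := C₂ d + (C₁ d + (2 * d + 4))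

/-- `ρ₀' < ρ₁'`. [cite: BringmannKunnemannFOCS2015, Claim 3.5] -/
theorem ρ₀'_lt_ρ₁' (d : ℕ) : ρ₀' d < ρ₁' d := by
  unfold ρ₀' ρ₁'; omega

/-- `NVG(a)` unfolded as a list of two guarded blocks. [folklore] -/
theorem ofFn_pairSX (a : Fin d → Bool) : List.ofFn (pairSX a) = [vgS d, vgX a] := by
  simp [List.ofFn_succ, pairSX]

/-- `NVG(b)` unfolded. [folklore] -/
theorem ofFn_singleY (b : Fin d → Bool) : List.ofFn (singleY b) = [vgY b] := by
  simp [singleY]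

/-- `|NVG(a)| = 2 (8γ₁' + ℓₓ') + γ₂'`. [folklore] -/
theorem length_nvgX (a : Fin d → Bool) :
    (nvgX a).length = 2 * (8 * (P₂ d).γ₁ + (P₂ d).ℓx) + (P₂ d).γ₂ := by
  unfold nvgX
  rw [(P₂ d).length_gadgetX (ℓ := (P₂ d).ℓx) _ ?_]
  · simp
  · intro z hz
    rw [ofFn_pairSX] at hz
    simp only [List.mem_cons, List.not_mem_nil, or_false] at hz
    rcases hz with rfl | rfl
    · exact length_vgS d
    · exact length_vgX a

/-- `#₁ NVG(a) = 2 (4γ₁' + sₓ')`. [folklore] -/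
theorem count_nvgX (a : Fin d → Bool) :
    (nvgX a).count true = 2 * (4 * (P₂ d).γ₁ + (P₂ d).sx) := by
  unfold nvgX
  rw [(P₂ d).count_true_gadgetX (s := (P₂ d).sx) _ ?_]
  · simp
  · intro z hz
    rw [ofFn_pairSX] at hz
    simp only [List.mem_cons, List.not_mem_nil, or_false] at hz
    rcases hz with rfl | rfl
    · exact count_vgS d
    · exact count_vgX a

/-- `|NVG(b)| = 4γ₃' + (8γ₁' + ℓ_y')`. [folklore] -/
theorem length_nvgY (b : Fin d → Bool) :
    (nvgY b).length = 2 * (2 * (P₂ d).γ₃) + (8 * (P₂ d).γ₁ + (P₂ d).ℓy) := by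
  unfold nvgY
  rw [(P₂ d).length_gadgetY (ℓ := (P₂ d).ℓy) _ _ ?_]
  · simp
  · intro z hz
    rw [ofFn_singleY] at hz
    simp only [List.mem_cons, List.not_mem_nil, or_false] at hz
    subst hz
    exact length_vgY b

section level2

variable (hAG : alignmentGadget_editDist)
include hAG

/-- **Level 2 of the construction**: `δ(NVG a, NVG b) = C' + min (δ(S, VG b)) (δ(VG a, VG b))`
(the three alignments of `[1]` into `[2]` are `{(1,1)}`, `{(2,1)}`, `∅`; BK15 Claim 3.5, proof).
[cite: BringmannKunnemannFOCS2015, Claim 3.5 (proof)] -/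
theorem editDist_nvgX_nvgY_eq_min (a b : Fin d → Bool) :
    editDist (nvgX a) (nvgY b) =
      C₂ d + min (editDist (vgS d) (vgY b)) (editDist (vgX a) (vgY b)) := by
  have h := hAG 2 1 (P₂ d) (pairSX a) (singleY b) le_rfl (by norm_num) (by simp [P₂])
    (fun i => by
      unfold pairSX; split_ifs
      · exact length_vgS d
      · exact length_vgX a)
    (fun i => by
      unfold pairSX; split_ifs
      · exact count_vgS d
      · exact count_vgX a)
    (fun j => length_vgY b)
  obtain ⟨hup', A, hA, hlow'⟩ := h
  have hup : ∀ (Δ : ℕ) (hΔ : Δ + 1 ≤ 2),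
      editDist (nvgX a) (nvgY b) ≤ C₂ d + structuredCost (pairSX a) (singleY b) Δ hΔ := hup'
  have hlow : C₂ d + alignCost (pairSX a) (singleY b) A ≤ editDist (nvgX a) (nvgY b) := hlow'
  apply le_antisymm
  · -- the two structured alignments
    rcases le_total (editDist (vgS d) (vgY b)) (editDist (vgX a) (vgY b)) with hle | hle
    · rw [min_eq_left hle]
      refine (hup 0 (by norm_num)).trans (le_of_eq ?_)
      simp [structuredCost, pairSX, singleY]
    · rw [min_eq_right hle]
      refine (hup 1 (by norm_num)).trans (le_of_eq ?_)
      simp [structuredCost, pairSX, singleY]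
  · -- every alignment costs at least the minimum
    refine le_trans (Nat.add_le_add_left ?_ _) hlow
    have hlen : A.length ≤ 1 := hA.length_le
    have hmaxge : min (editDist (vgS d) (vgY b)) (editDist (vgX a) (vgY b)) ≤
        maxDist (pairSX a) (singleY b) :=
      (min_le_left _ _).trans (by
        simpa [pairSX, singleY] using editDist_le_maxDist (pairSX a) (singleY b) 0 0)
    unfold alignCost
    rcases A with _ | ⟨p, _ | ⟨q, A⟩⟩
    · simpa using hmaxge
    · simp only [List.map_cons, List.map_nil, List.sum_cons, List.sum_nil, add_zero,
        List.length_singleton, Nat.sub_self, zero_mul]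
      have : editDist (pairSX a p.1) (singleY b p.2) = editDist (vgS d) (vgY b) ∨
          editDist (pairSX a p.1) (singleY b p.2) = editDist (vgX a) (vgY b) := by
        unfold pairSX singleY; split_ifs <;> simp
      rcases this with h | h <;> rw [h]
      · exact min_le_left _ _
      · exact min_le_right _ _
    · simp at hlen

/-- **Claim 3.5**: `δ(NVG a, NVG b) = ρ₀'` if `⟨a, b⟩ = 0` and `= ρ₁'` otherwise.
[cite: BringmannKunnemannFOCS2015, Claim 3.5] -/
theorem editDist_nvgX_nvgY (a b : Fin d → Bool) :
    editDist (nvgX a) (nvgY b) = if AreOrthogonal a b then ρ₀' d else ρ₁' d := by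
  rw [editDist_nvgX_nvgY_eq_min hAG, editDist_vgS_vgY hAG]
  split_ifs with h
  · rw [editDist_vgX_vgY_of_areOrthogonal hAG h, min_eq_right (by omega)]; rfl
  · rw [min_eq_left (le_editDist_vgX_vgY_of_not_areOrthogonal hAG h)]; rfl

/-- In particular `ρ₀' ≤ δ(NVG a, NVG b) ≤ ρ₁'`. [cite: BringmannKunnemannFOCS2015, Claim 3.5] -/
theorem editDist_nvgX_nvgY_le (a b : Fin d → Bool) : editDist (nvgX a) (nvgY b) ≤ ρ₁' d := by
  rw [editDist_nvgX_nvgY hAG]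
  split_ifs
  · exact (ρ₀'_lt_ρ₁' d).le
  · exact le_rfl

end level2

/-! ### Level 3: the final strings and the threshold -/

/-- The level-3 parameters: the common type of the `NVG(aᵢ)` and the common length of the
`NVG(bⱼ)` (BK15 §3.1, `t_x''`, `t_y''`). [cite: BringmannKunnemannFOCS2015, §3.1 (types t_x'', t_y'')] -/
def P₃ (d : ℕ) : Params where
  ℓx := 2 * (8 * (P₂ d).γ₁ + (P₂ d).ℓx) + (P₂ d).γ₂
  ℓy := 2 * (2 * (P₂ d).γ₃) + (8 * (P₂ d).γ₁ + (P₂ d).ℓy)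
  sx := 2 * (4 * (P₂ d).γ₁ + (P₂ d).sx)

/-- At level 3 the `x`-inputs are not longer than the `y`-inputs (side condition of the vendored
Lemma 5.4). [folklore] -/
theorem P₃_ℓx_le_ℓy (d : ℕ) : (P₃ d).ℓx ≤ (P₃ d).ℓy := by
  simp only [P₃, P₂, Params.γ₁, Params.γ₂, Params.γ₃]
  omega

/-- `2n` indices reduce modulo `n` (for `i < 2n` we have `0 < n`). [folklore] -/
theorem mod_lt_of_lt_two_mul {n i : ℕ} (hi : i < 2 * n) : i % n < n :=
  Nat.mod_lt _ (by omega)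

/-- The `2n` `x`-inputs of the final gadget: `NVG(a₀), …, NVG(a_{n-1})` twice (BK15 §3.1, the
string `x`). [cite: BringmannKunnemannFOCS2015, §3.1 (the final strings x, y)] -/
def xs (I : OVInstance) : Fin (2 * I.n) → List Bool :=
  fun i => nvgX (I.A ⟨(i : ℕ) % I.n, mod_lt_of_lt_two_mul i.isLt⟩)

/-- The `n` `y`-inputs of the final gadget: `NVG(b₀), …, NVG(b_{n-1})` (BK15 §3.1, the string `y`).
[cite: BringmannKunnemannFOCS2015, §3.1 (the final strings x, y)] -/
def ys (I : OVInstance) : Fin I.n → List Bool :=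
  fun j => nvgY (I.B j)

/-- **The first string of the reduction**, `x = GA_x^{n}(NVG(a₀),…,NVG(a_{n-1}),NVG(a₀),…,NVG(a_{n-1}))`
(BK15 §3.1). [cite: BringmannKunnemannFOCS2015, §3.1 (the final strings x, y)] -/
def ovX (I : OVInstance) : List Bool :=
  (P₃ I.d).gadgetX (List.ofFn (xs I))

/-- **The second string of the reduction**, `y = GA_y^{2n}(NVG(b₀),…,NVG(b_{n-1}))` (BK15 §3.1).
[cite: BringmannKunnemannFOCS2015, §3.1 (the final strings x, y)] -/
def ovY (I : OVInstance) : List Bool :=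
  (P₃ I.d).gadgetY (2 * I.n) (List.ofFn (ys I))

/-- `C₃ = C''`, the offset of the level-3 alignment gadget (`2n` inputs against `n`).
[cite: BringmannKunnemannFOCS2015, §3.1 (the constant C'')] -/
def C₃ (I : OVInstance) : ℕ := (P₃ I.d).C (2 * I.n) I.n

/-- **The threshold** `ρ = C'' + (m-1) ρ₁' + ρ₀'` (here `m = n`; BK15 §3.1, end of the proof of
Thm. 3.3). [cite: BringmannKunnemannFOCS2015, §3.1 (the threshold ρ)] -/
def ovThreshold (I : OVInstance) : ℕ := C₃ I + (I.n - 1) * ρ₁' I.d + ρ₀' I.d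

/-- `|x| = 2n ℓₓ'' + (2n - 1) γ₂''`. [folklore] -/
theorem length_ovX (I : OVInstance) :
    (ovX I).length = 2 * I.n * (8 * (P₃ I.d).γ₁ + (P₃ I.d).ℓx) + (2 * I.n - 1) * (P₃ I.d).γ₂ := by
  unfold ovX
  rw [(P₃ I.d).length_gadgetX (ℓ := (P₃ I.d).ℓx) _ ?_]
  · simp
  · intro z hz
    simp only [List.mem_ofFn', Set.mem_range] at hz
    obtain ⟨i, rfl⟩ := hz
    exact length_nvgX _

/-- `|y| = 4n γ₃'' + n (8γ₁'' + ℓ_y'') + (n-1) γ₂''`. [folklore] -/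
theorem length_ovY (I : OVInstance) :
    (ovY I).length = 2 * (2 * I.n * (P₃ I.d).γ₃) +
      (I.n * (8 * (P₃ I.d).γ₁ + (P₃ I.d).ℓy) + (I.n - 1) * (P₃ I.d).γ₂) := by
  unfold ovY
  rw [(P₃ I.d).length_gadgetY (ℓ := (P₃ I.d).ℓy) _ _ ?_]
  · simp
  · intro z hz
    simp only [List.mem_ofFn', Set.mem_range] at hz
    obtain ⟨j, rfl⟩ := hz
    exact length_nvgY _

section level3

variable (hAG : alignmentGadget_editDist)
include hAG

/-- Lemma 5.4 at level 3 (needs `n ≥ 1`). [cite: BringmannKunnemannFOCS2015, Lemma 5.4] -/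
theorem gadget₃ (I : OVInstance) (hn : 1 ≤ I.n) :
    (∀ (Δ : ℕ) (hΔ : Δ + I.n ≤ 2 * I.n),
        editDist (ovX I) (ovY I) ≤ C₃ I + structuredCost (xs I) (ys I) Δ hΔ) ∧
    (∃ A : List (Fin (2 * I.n) × Fin I.n), IsAlignment A ∧
        C₃ I + alignCost (xs I) (ys I) A ≤ editDist (ovX I) (ovY I)) :=
  hAG (2 * I.n) I.n (P₃ I.d) (xs I) (ys I) hn (by omega) (P₃_ℓx_le_ℓy I.d)
    (fun i => length_nvgX _) (fun i => count_nvgX _) (fun j => length_nvgY _)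

/-- **Claim 3.6, no orthogonal pair**: `δ(x, y) ≥ C'' + n ρ₁'`. [cite: BringmannKunnemannFOCS2015, Claim 3.6] -/
theorem le_editDist_ovX_ovY_of_not_hasOrthogonalPair (I : OVInstance) (hn : 1 ≤ I.n)
    (h : ¬ I.HasOrthogonalPair) : C₃ I + I.n * ρ₁' I.d ≤ editDist (ovX I) (ovY I) := by
  obtain ⟨-, A, hA, hlow⟩ := gadget₃ hAG I hn
  refine le_trans (Nat.add_le_add_left ?_ _) hlow
  refine mul_le_alignCost (by omega) (fun i j => ?_) hA
  unfold xs ys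
  rw [editDist_nvgX_nvgY hAG, if_neg]
  exact fun hij => h ⟨_, j, hij⟩

/-- **Claim 3.6, an orthogonal pair**: `δ(x, y) ≤ C'' + (n-1) ρ₁' + ρ₀' = ρ`, via the structured
alignment `Δ = (i - j) mod n`. [cite: BringmannKunnemannFOCS2015, Claim 3.6] -/
theorem editDist_ovX_ovY_le_of_hasOrthogonalPair (I : OVInstance) (hn : 1 ≤ I.n)
    (h : I.HasOrthogonalPair) : editDist (ovX I) (ovY I) ≤ ovThreshold I := by
  obtain ⟨hup, -⟩ := gadget₃ hAG I hn
  obtain ⟨i, j, hij⟩ := h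
  -- the shift aligning `xs (Δ + j) = NVG(a_i)` with `ys j = NVG(b_j)`
  set Δ : ℕ := if (j : ℕ) ≤ i then i - j else I.n + i - j with hΔdef
  have hΔ : Δ + I.n ≤ 2 * I.n := by
    rw [hΔdef]; split_ifs <;> omega
  have hmod : (Δ + j) % I.n = i := by
    rw [hΔdef]
    split_ifs with hji
    · rw [Nat.sub_add_cancel hji]; exact Nat.mod_eq_of_lt i.isLt
    · have : I.n + i - j + j = i + I.n := by omega
      rw [this, Nat.add_mod_right]; exact Nat.mod_eq_of_lt i.isLt
  refine (hup Δ hΔ).trans ?_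
  unfold ovThreshold
  rw [add_assoc]
  refine Nat.add_le_add_left ?_ _
  -- the structured cost: the summand `j` is `ρ₀'`, all others are `≤ ρ₁'`
  unfold structuredCost
  rw [← Finset.add_sum_erase _ _ (Finset.mem_univ j)]
  have hj : editDist (xs I ⟨Δ + j, by omega⟩) (ys I j) = ρ₀' I.d := by
    unfold xs ys
    rw [editDist_nvgX_nvgY hAG, if_pos]
    simp only [hmod]
    exact hij
  rw [hj, add_comm]
  refine Nat.add_le_add_right ?_ _
  calc ∑ x ∈ Finset.univ.erase j, editDist (xs I ⟨Δ + x, by omega⟩) (ys I x)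
      ≤ ∑ x ∈ Finset.univ.erase j, ρ₁' I.d :=
        Finset.sum_le_sum fun j' _ => by unfold xs ys; exact editDist_nvgX_nvgY_le hAG _ _
    _ = (I.n - 1) * ρ₁' I.d := by
        rw [Finset.sum_const, smul_eq_mul, Finset.card_erase_of_mem (Finset.mem_univ j),
          Finset.card_univ, Fintype.card_fin]

/-- **The reduction is correct** (BK15, end of the proof of Thm. 3.3: "we have found a threshold
such that `δ(x,y) ≤ ρ` if and only if there is a pair `(i,j)` with `⟨aᵢ, bⱼ⟩ = 0`"), for
instances with at least one vector per list, assuming Lemma 5.4 (`alignmentGadget_editDist`).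
[cite: BringmannKunnemannFOCS2015, Thm. 3.3 (proof, §3.1)] -/
theorem editDist_ovX_ovY_le_iff (I : OVInstance) (hn : 1 ≤ I.n) :
    editDist (ovX I) (ovY I) ≤ ovThreshold I ↔ I.HasOrthogonalPair := by
  refine ⟨fun h => ?_, editDist_ovX_ovY_le_of_hasOrthogonalPair hAG I hn⟩
  by_contra hno
  have h1 := le_editDist_ovX_ovY_of_not_hasOrthogonalPair hAG I hn hno
  have h2 : ovThreshold I < C₃ I + I.n * ρ₁' I.d := by
    unfold ovThreshold
    have := ρ₀'_lt_ρ₁' I.d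
    obtain ⟨k, hk⟩ : ∃ k, I.n = k + 1 := ⟨I.n - 1, by omega⟩
    rw [hk, Nat.add_sub_cancel, Nat.add_mul, one_mul]
    omega
  omega

end level3

end BKReduction

end Literature.Computability.FineGrained
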